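import Mathlib.Logic.Equiv.Option
import Mathlib.SetTheory.Cardinal.NatCard
import Literature.Geometry.Symplectic.LefschetzSteinOpenBookTransport
import Literature.Geometry.Symplectic.LefschetzSteinOpenBookHandleFree
import HarnessLib

/-!
# PALF ⇒ Stein with supported boundary open book: the induction over the Lefschetz handles
# (skeleton), re-indexing of models, and the model of the empty family

Topic `Literature/Geometry/Symplectic`; a proofs-only companion (no definition, no named fact;
D-0026) of `LefschetzSteinOpenBook.lean`, whose single named fact
`Literature.Geometry.Symplectic.palf_stein_supportedByBoundaryOpenBook` (**S2**: Akbulut–Ozbagci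
2001, Thm. 5, with Gay 2002, Prop. 2.8; Etnyre 2006, Thms. 5.4–5.6; Baykur 2006, p. 14) is the
printed INDUCTION *"`X₀ = D² × F ⤳ X₁ ⤳ ⋯ ⤳ Xₙ = X`, where each `X_{i−1}` is a PALF and `Xᵢ` is
obtained from `X_{i−1}` by attaching a 2-handle to a nonseparating curve lying on a fiber … with
framing one less than the fibre framing; inductively `X_{i−1}` has a Stein structure"*
(Akbulut–Ozbagci, proof of Thm. 5), *"and as shown by Gay, the new open book on `∂Xᵢ` will be
compatible with the new induced contact structure. This completes the induction"* (Baykur, p. 14).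

The FIRST STEP of that induction is proved in the tree
(`palf_stein_supportedByBoundaryOpenBook_handleFree`, `LefschetzSteinOpenBookHandleFree.lean`:
the fact for an empty family of vanishing cycles).  This file proves the INDUCTION ITSELF, i.e.
reduces the named fact to its one-handle step, displayed inline as the hypothesis `Hstep` of
`palf_stein_supportedByBoundaryOpenBook_of_consStep` in the vocabulary of
`HandleAttachingMapsAssoc.lean` (`consFamily h' h : Option ι → …`, the family "`h` and one more
attaching map `h'`", for which `MultiAttachmentData.isMultiAttachment_cons` says that attaching
one handle along `jA ∘ h'` to a multi-attachment of `h` IS a multi-attachment of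
`consFamily h' h`):

* **(Hstep, displayed, not named)** for every positive allowable family `h` on `Base g` which HAS
  a model — a compact multi-attachment `(X₀, D₀)` with a boundary datum `bX₀`, a Kas open book
  `ob₀` (`IsKasOpenBookOf`), a Stein structure `S₀` and a Giroux form `α₀` of `ob₀` for its
  complex tangencies, positive for the complex boundary orientation (exactly the package `H` of
  `palf_stein_supportedByBoundaryOpenBook_of_models`) — and every further attaching map `h'`
  missing the `h i`, with attaching circle in a page, non-zero shadow and page twisting `-1`,
  the family `consFamily h' h` has a model.  This is the printed inductive step "attach one more
  positive Lefschetz handle along a non-separating curve in a page: Legendrian realisation,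
  Eliashberg's handle, Gay's Prop. 2.8", as one Lean statement;
* `palf_stein_supportedByBoundaryOpenBook_of_consStep : Hstep → palf_stein_supportedByBoundaryOpenBook`
  — by induction on `Nat.card ι`: the empty family has the model `Base g` itself
  (`exists_palfModel_of_isEmpty`, from the handle-free theorem), a non-empty family `h` is, up to
  the re-indexing `Equiv.optionSubtypeNe i₀ : Option {i // i ≠ i₀} ≃ ι`, the family
  `consFamily (h i₀) (h|_{i ≠ i₀})`, models are transported along re-indexings of the family
  (`exists_palfModel_of_comp_equiv`) and along equalities of families
  (`exists_palfModel_congr`), and from a model of `h` the conclusion of the fact for EVERY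
  multi-attachment of `h` is `palf_conclusion_of_model` (`LefschetzSteinOpenBookTransport.lean`).

Re-indexing (`exists_palfModel_of_comp_equiv`): for `σ : κ ≃ ι` the cores-complements of `h ∘ σ`
and `h` are the same open subset of `Base g` (`coresComplement_comp_equiv`); a multi-attachment
datum of `h ∘ σ` becomes one of `h` by composing `jA` with the inclusion between the two (equal)
open submanifolds and re-indexing `jB`; the Kas clauses, the frames `d(jA)` and the positive
boundary frames (`IsPosBdryFrame`, through `ambientC`) are unchanged because that inclusion is the
identity in charts (`mfderiv_comp_opensInclusion_of_eq`, proved by substituting the equality of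
the two `Opens`).

Remark on `palf_stein_supportedByBoundaryOpenBook_of_models` / `_of_reebModels`
(`LefschetzSteinOpenBookTransport.lean`, `LefschetzSteinOpenBookReeb.lean`): their hypothesis asks
for a model of EVERY family `h` satisfying the three clauses on the attaching circles, without
the pairwise disjointness of the ranges of the `h i`; since a `MultiAttachmentData h …` contains
that disjointness, no model exists for an overlapping family and that hypothesis cannot be
instantiated as stated.  The theorems here therefore carry `Pairwise (Disjoint on ranges)`
explicitly (it is available from the datum `D` quantified in the fact) and conclude through
`palf_conclusion_of_model` directly.

## What `Hstep` still requires (status 2026-08-17; for the decomposition of S2)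

With a model `(X₀, D₀, bX₀, ob₀, S₀, α₀)` of `h` in hand and `K = D₀.jA ∘ h'`-circle, a curve in
a page of the Kas open book `ob₀` with handle framing = page framing `− 1`:
1. *Legendrian realisation of `K`* (Honda 2000, Thm. 3.7 on the double of a page; Etnyre 2006,
   proof of Thm. 5.6).  In the tree's setting a route without convex-surface theory is: a Giroux
   form `α'` of `ob₀`, positive like `α₀`, with `α'|_{TK} = 0` (Thurston–Winkelnkemper type
   modification on the page, using that `K` is non-separating: `shadow ≠ 0` gives `[K] ≠ 0` in
   `H₁(Base g; ℤ)` by linearity of `shadowMap`), then `GirouxContactPath_holds` +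
   `GrayStability_holds` (both proved, `GirouxContactPath*.lean`, `GrayStability*.lean`) give an
   ambient isotopy `Ψ_t` of `∂X₀` with `TΨ₁(ker α') = ξ_{S₀}`, isotopy extension over a collar
   (`BoundaryData.exists_diffeomorph_comp_incl_eq_of_isDiffeotopicToId`) a diffeomorphism `Φ` of
   `X₀`, and `S₀.comap Φ` has complex tangencies `ker α'`, for which `K` is Legendrian and `ob₀`
   is still in Giroux form; the contact framing of `K` is then its page framing (the Reeb field
   is transverse to pages).  Missing pieces: the `α'` construction (needs a closed 1-form on the
   page with non-zero period on `K`, i.e. the passage from `[K] ≠ 0` to a dual curve / form) and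
   the framing comparison.
2. *Eliashberg's Stein 2-handle with control of the boundary contact structure* (Eliashberg 1990;
   Weinstein 1991; Etnyre 2006, Thm. 5.4: the new boundary is the Legendrian surgery
   `(M_{(K,−1)}, ξ_{(K,−1)})`).  The tree's E2 `Gompf1998_thm13_twoHandles` concludes only
   `IsSteinDomain` and is too weak; the capped model handle IS in the tree
   (`SteinHandleModelStein.lean`, `HandleProfile.isSteinDomain_cappedHandle`), the holomorphic
   gluing to an arbitrary `(X₀, S₀)` along `K` is not.
3. *The surgered open book supports the surgered contact structure* (Gay 2002, Prop. 2.8 =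
   Etnyre 2006, Thm. 5.5), together with the topological identification of the Kas open book of
   `X₀ ∪ H` (pages extended over the Lefschetz handle, monodromy composed with the Dehn twist
   along `K`) — the one-handle case of the summit-side construction
   `helper_kasOpenBook_of_seamFunction`.
Items 2–3 are chapters (Cieliebak–Eliashberg 2012, Part II; Etnyre 2006, §5); nothing here
pretends otherwise.  This file only fixes the statement they must jointly deliver.

## References
* S. Akbulut, B. Ozbagci, *Lefschetz fibrations on compact Stein surfaces*, Geom. Topol. 5
  (2001), 319–334, Thm. 5 and its proof (arXiv:math/0012239, p. 8). [AkbulutOzbagci2001]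
* D. T. Gay, *Explicit concave fillings of contact three-manifolds*, Math. Proc. Camb. Phil.
  Soc. 133 (2002), Prop. 2.8. [Gay2002]
* J. B. Etnyre, *Lectures on open book decompositions and contact structures*, Clay Math. Proc.
  5 (2006), Thms. 5.4–5.6. [Etnyre2006]
* R. İ. Baykur, *Kähler decomposition of 4-manifolds*, Algebr. Geom. Topol. 6 (2006), proof of
  Thm. 5.1, p. 14. [Baykur2006]
* K. Honda, *On the classification of tight contact structures I*, Geom. Topol. 4 (2000),
  Thm. 3.7. [Honda2000]
* A. A. Kosinski, *Differential Manifolds* (1993), VI §6–7 (handles attached one at a time /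
  simultaneously). [Kosinski1993]
-/

noncomputable section

open scoped Manifold ContDiff Topology
open Set Function

namespace Literature.Geometry.Symplectic

open Literature.Topology.FourManifolds Literature.Topology.FourManifolds.HandleAttachingMap
  Literature.Topology.FourManifolds.LefschetzBase Literature.Geometry.Kaehler

/-! ### Inclusions between equal open submanifolds are the identity in charts -/

section OpensEq

variable {E H : Type*} [NormedAddCommGroup E] [NormedSpace ℝ E] [TopologicalSpace H]
  {I : ModelWithCorners ℝ E H} {M : Type*} [TopologicalSpace M] [ChartedSpace H M]
  {E' H' : Type*} [NormedAddCommGroup E'] [NormedSpace ℝ E'] [TopologicalSpace H']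
  {I' : ModelWithCorners ℝ E' H'} {N : Type*} [TopologicalSpace N] [ChartedSpace H' N]

/-- The inclusion of an open subset into itself is the identity. [folklore] -/
theorem opensInclusion_self_eq_id (U : TopologicalSpace.Opens M) (hle : U ≤ U) :
    (TopologicalSpace.Opens.inclusion hle : U → U) = id :=
  funext fun _ => Subtype.ext rfl

/-- Composing with the inclusion between two EQUAL open subsets does not change the range.
[folklore] -/
theorem range_comp_opensInclusion_of_eq {U V : TopologicalSpace.Opens M} (e : U = V)
    {β : Type*} (f : V → β) :
    range (f ∘ TopologicalSpace.Opens.inclusion e.le) = range f := by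
  subst e
  rw [opensInclusion_self_eq_id U, Function.comp_id]

/-- Composing a smooth embedding with the inclusion between two EQUAL open submanifolds gives a
smooth embedding. [folklore] -/
theorem isSmoothEmbedding_comp_opensInclusion_of_eq {U V : TopologicalSpace.Opens M} (e : U = V)
    {f : V → N} (hf : Manifold.IsSmoothEmbedding I I' ∞ f) :
    Manifold.IsSmoothEmbedding I I' ∞ (f ∘ TopologicalSpace.Opens.inclusion e.le) := by
  subst e
  rw [opensInclusion_self_eq_id U, Function.comp_id]
  exact hf

/-- The differential of `f ∘ (inclusion)` between two EQUAL open submanifolds is the differential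
of `f` (the inclusion is the identity in charts). [folklore] -/
theorem mfderiv_comp_opensInclusion_of_eq {U V : TopologicalSpace.Opens M} (e : U = V)
    (f : V → N) (a : U) (v : E) :
    mfderiv I I' (f ∘ TopologicalSpace.Opens.inclusion e.le) a v =
      mfderiv I I' f (TopologicalSpace.Opens.inclusion e.le a) v := by
  subst e
  rw [opensInclusion_self_eq_id U, Function.comp_id]
  rfl

end OpensEq

/-! ### Re-indexing a family of attaching maps -/

section Reindex

variable {n k : ℕ} {M : Type*} [TopologicalSpace M] [T2Space M]
  [ChartedSpace (EuclideanHalfSpace (n + 1)) M] {ι κ : Type*} [Finite ι] [Finite κ]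

/-- **The cores-complement is invariant under re-indexing**: for `σ : κ ≃ ι`,
`M ∖ ⋃ⱼ h(σ j)(S) = M ∖ ⋃ᵢ hᵢ(S)`. [folklore] -/
theorem coresComplement_comp_equiv (h : ι → HandleAttachingMap n k M) (σ : κ ≃ ι) :
    coresComplement (h ∘ σ) = coresComplement h := by
  ext a
  show a ∈ coresComplement (h ∘ σ) ↔ a ∈ coresComplement h
  simp only [mem_coresComplement, Function.comp_apply]
  exact ⟨fun H i => by simpa using H (σ.symm i), fun H j => H (σ j)⟩

end Reindex

/-! ### Models of a positive allowable family, and their transport -/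

/-- **Models transport along an equality of families.**  If `k = k'` then a model of `k` (a
compact multi-attachment with boundary datum, Kas open book, Stein structure and positive Giroux
form — the package `H` of `palf_stein_supportedByBoundaryOpenBook_of_models`) is a model of `k'`.
[folklore] -/
theorem exists_palfModel_congr {g : ℕ} {κ : Type} [Finite κ]
    {k k' : κ → HandleAttachingMap 3 2 (Base g)} (e : k = k')
    (H : ∃ (X₀ : Type) (_ : TopologicalSpace X₀) (_ : T2Space X₀)
        (_ : ChartedSpace (EuclideanHalfSpace 4) X₀) (_ : IsManifold (𝓡∂ 4) ∞ X₀)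
        (_ : CompactSpace X₀) (D₀ : MultiAttachmentData k (𝓡∂ 4) X₀)
        (bX₀ : BoundaryData (𝓡∂ 4) X₀ (𝓡 3)) (ob₀ : OpenBook bX₀.carrier),
        IsKasOpenBookOf g k D₀ bX₀.incl ob₀ ∧
        ∃ (S₀ : SteinStructure X₀) (α₀ : MForm (𝓡 3) bX₀.carrier ℝ 1),
          ob₀.IsGirouxForm (boundaryPlaneField S₀.J bX₀) α₀ ∧
          ∀ (y : bX₀.carrier) (a : ↥(coresComplement k))
            (u : Fin 3 → EuclideanSpace ℝ (Fin 3)) (v : Fin 3 → EuclideanSpace ℝ (Fin 4)),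
            bX₀.incl y = D₀.jA a →
            (∀ j, mfderiv (𝓡 3) (𝓡∂ 4) bX₀.incl y (u j) =
              mfderiv (𝓡∂ 4) (𝓡∂ 4) D₀.jA a (v j)) →
            IsPosBdryFrame k a v →
            0 < wedge₁₂ (α₀ y) (mextDeriv α₀ y) (u 0) (u 1) (u 2)) :
    ∃ (X₀ : Type) (_ : TopologicalSpace X₀) (_ : T2Space X₀)
        (_ : ChartedSpace (EuclideanHalfSpace 4) X₀) (_ : IsManifold (𝓡∂ 4) ∞ X₀)
        (_ : CompactSpace X₀) (D₀ : MultiAttachmentData k' (𝓡∂ 4) X₀)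
        (bX₀ : BoundaryData (𝓡∂ 4) X₀ (𝓡 3)) (ob₀ : OpenBook bX₀.carrier),
        IsKasOpenBookOf g k' D₀ bX₀.incl ob₀ ∧
        ∃ (S₀ : SteinStructure X₀) (α₀ : MForm (𝓡 3) bX₀.carrier ℝ 1),
          ob₀.IsGirouxForm (boundaryPlaneField S₀.J bX₀) α₀ ∧
          ∀ (y : bX₀.carrier) (a : ↥(coresComplement k'))
            (u : Fin 3 → EuclideanSpace ℝ (Fin 3)) (v : Fin 3 → EuclideanSpace ℝ (Fin 4)),
            bX₀.incl y = D₀.jA a →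
            (∀ j, mfderiv (𝓡 3) (𝓡∂ 4) bX₀.incl y (u j) =
              mfderiv (𝓡∂ 4) (𝓡∂ 4) D₀.jA a (v j)) →
            IsPosBdryFrame k' a v →
            0 < wedge₁₂ (α₀ y) (mextDeriv α₀ y) (u 0) (u 1) (u 2) := by
  subst e
  exact H

/-- **Models transport along a re-indexing of the family.**  For `σ : κ ≃ ι`, a model of the
family `h ∘ σ` is a model of `h`: the cores-complements agree (`coresComplement_comp_equiv`), the
base embedding `jA` is composed with the inclusion between the two equal open submanifolds of
`Base g` (the identity in charts), the handle embeddings are re-indexed by `σ⁻¹`, and the Kas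
clauses, the frames `d(jA)(v)` and the positive boundary frames are literally unchanged.
[folklore] -/
theorem exists_palfModel_of_comp_equiv {g : ℕ} {ι κ : Type} [Finite ι] [Finite κ]
    {h : ι → HandleAttachingMap 3 2 (Base g)} (σ : κ ≃ ι)
    (H : ∃ (X₀ : Type) (_ : TopologicalSpace X₀) (_ : T2Space X₀)
        (_ : ChartedSpace (EuclideanHalfSpace 4) X₀) (_ : IsManifold (𝓡∂ 4) ∞ X₀)
        (_ : CompactSpace X₀) (D₀ : MultiAttachmentData (h ∘ σ) (𝓡∂ 4) X₀)
        (bX₀ : BoundaryData (𝓡∂ 4) X₀ (𝓡 3)) (ob₀ : OpenBook bX₀.carrier),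
        IsKasOpenBookOf g (h ∘ σ) D₀ bX₀.incl ob₀ ∧
        ∃ (S₀ : SteinStructure X₀) (α₀ : MForm (𝓡 3) bX₀.carrier ℝ 1),
          ob₀.IsGirouxForm (boundaryPlaneField S₀.J bX₀) α₀ ∧
          ∀ (y : bX₀.carrier) (a : ↥(coresComplement (h ∘ σ)))
            (u : Fin 3 → EuclideanSpace ℝ (Fin 3)) (v : Fin 3 → EuclideanSpace ℝ (Fin 4)),
            bX₀.incl y = D₀.jA a →
            (∀ j, mfderiv (𝓡 3) (𝓡∂ 4) bX₀.incl y (u j) =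
              mfderiv (𝓡∂ 4) (𝓡∂ 4) D₀.jA a (v j)) →
            IsPosBdryFrame (h ∘ σ) a v →
            0 < wedge₁₂ (α₀ y) (mextDeriv α₀ y) (u 0) (u 1) (u 2)) :
    ∃ (X₀ : Type) (_ : TopologicalSpace X₀) (_ : T2Space X₀)
        (_ : ChartedSpace (EuclideanHalfSpace 4) X₀) (_ : IsManifold (𝓡∂ 4) ∞ X₀)
        (_ : CompactSpace X₀) (D₀ : MultiAttachmentData h (𝓡∂ 4) X₀)
        (bX₀ : BoundaryData (𝓡∂ 4) X₀ (𝓡 3)) (ob₀ : OpenBook bX₀.carrier),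
        IsKasOpenBookOf g h D₀ bX₀.incl ob₀ ∧
        ∃ (S₀ : SteinStructure X₀) (α₀ : MForm (𝓡 3) bX₀.carrier ℝ 1),
          ob₀.IsGirouxForm (boundaryPlaneField S₀.J bX₀) α₀ ∧
          ∀ (y : bX₀.carrier) (a : ↥(coresComplement h))
            (u : Fin 3 → EuclideanSpace ℝ (Fin 3)) (v : Fin 3 → EuclideanSpace ℝ (Fin 4)),
            bX₀.incl y = D₀.jA a →
            (∀ j, mfderiv (𝓡 3) (𝓡∂ 4) bX₀.incl y (u j) =
              mfderiv (𝓡∂ 4) (𝓡∂ 4) D₀.jA a (v j)) →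
            IsPosBdryFrame h a v →
            0 < wedge₁₂ (α₀ y) (mextDeriv α₀ y) (u 0) (u 1) (u 2) := by
  obtain ⟨X₀, _, _, _, _, _, D₀, bX₀, ob₀, hK₀, S₀, α₀, hG₀, hpos₀⟩ := H
  have e : coresComplement (h ∘ σ) = coresComplement h := coresComplement_comp_equiv h σ
  -- the inclusions between the two (equal) cores-complements
  set inc : ↥(coresComplement h) → ↥(coresComplement (h ∘ σ)) :=
    TopologicalSpace.Opens.inclusion e.symm.le with hinc
  set inc' : ↥(coresComplement (h ∘ σ)) → ↥(coresComplement h) :=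
    TopologicalSpace.Opens.inclusion e.le with hinc'
  have hinc_inc' : ∀ a, inc (inc' a) = a := fun a => Subtype.ext rfl
  -- the re-indexed multi-attachment datum
  let D : MultiAttachmentData h (𝓡∂ 4) X₀ :=
    { disjoint := fun i j hne => by
        have := D₀.disjoint (σ.symm.injective.ne hne)
        simpa only [Function.comp_apply, Equiv.apply_symm_apply] using this
      jA := D₀.jA ∘ inc
      jB := fun i => D₀.jB (σ.symm i)
      hjA := isSmoothEmbedding_comp_opensInclusion_of_eq e.symm D₀.hjA
      hjAo := by
        rw [range_comp_opensInclusion_of_eq e.symm]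
        exact D₀.hjAo
      hjB := fun i => D₀.hjB (σ.symm i)
      cover := by
        rw [range_comp_opensInclusion_of_eq e.symm]
        have : (⋃ i, range (D₀.jB (σ.symm i))) = ⋃ j, range (D₀.jB j) :=
          σ.symm.surjective.iUnion_comp fun j => range (D₀.jB j)
        rw [this]
        exact D₀.cover
      glue := fun i a b => by
        have := D₀.glue (σ.symm i) (inc a) b
        simpa only [Function.comp_apply, Equiv.apply_symm_apply] using this
      disjointB := fun i j hne => D₀.disjointB (σ.symm.injective.ne hne) }
  have hjA : ∀ a, D.jA a = D₀.jA (inc a) := fun a => rfl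
  refine ⟨X₀, inferInstance, inferInstance, inferInstance, inferInstance, inferInstance, D, bX₀,
    ob₀, ⟨fun y => ?_, fun y a hya hw => ?_⟩, S₀, α₀, hG₀, fun y a u v hya hframe hfr => ?_⟩
  · -- (K1) the binding
    rw [hK₀.1 y]
    constructor
    · rintro ⟨a, ha, hw⟩
      refine ⟨inc' a, ?_, hw⟩
      rw [hjA, hinc_inc']
      exact ha
    · rintro ⟨a, ha, hw⟩
      exact ⟨inc a, ha, hw⟩
  · -- (K2) the fibration
    exact hK₀.2 y (inc a) hya hw
  · -- positivity on positive boundary frames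
    refine hpos₀ y (inc a) u v hya (fun j => ?_) ?_
    · rw [hframe j]
      exact mfderiv_comp_opensInclusion_of_eq e.symm D₀.jA a (v j)
    · have hamb : ∀ w, ambientC (h ∘ σ) (inc a) w = ambientC h a w := fun w =>
        (mfderiv_comp_opensInclusion_of_eq (I := 𝓡∂ 4) (I' := 𝓘(ℝ, EuclideanSpace ℝ (Fin 4)))
          e.symm (fun q : ↥(coresComplement (h ∘ σ)) =>
            ((q : Base g).1 : EuclideanSpace ℝ (Fin 4))) a w).symm
      unfold IsPosBdryFrame at hfr ⊢
      rw [hamb, hamb, hamb]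
      exact hfr

/-- **The empty family has a model: the base itself** (Akbulut–Ozbagci 2001, proof of Thm. 5,
first step; Torisu 2000).  For `h : ι → …` with `ι` empty, `X₀ = Base g` with `jA` the inclusion
of the cores-complement (all of `Base g`), the boundary datum `bBase g` and the boundary open
book `boundaryOpenBook g` (which is the Kas open book, as in
`exists_multiAttachmentData_isKasOpenBookOf_base`) is a model, the Stein structure and the
positive Giroux form being `palf_stein_supportedByBoundaryOpenBook_handleFree`.
[cite: AkbulutOzbagci2001, Thm. 5] -/
theorem exists_palfModel_of_isEmpty (g : ℕ) {ι : Type} [Finite ι] [IsEmpty ι]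
    (h : ι → HandleAttachingMap 3 2 (Base g)) :
    ∃ (X₀ : Type) (_ : TopologicalSpace X₀) (_ : T2Space X₀)
        (_ : ChartedSpace (EuclideanHalfSpace 4) X₀) (_ : IsManifold (𝓡∂ 4) ∞ X₀)
        (_ : CompactSpace X₀) (D₀ : MultiAttachmentData h (𝓡∂ 4) X₀)
        (bX₀ : BoundaryData (𝓡∂ 4) X₀ (𝓡 3)) (ob₀ : OpenBook bX₀.carrier),
        IsKasOpenBookOf g h D₀ bX₀.incl ob₀ ∧
        ∃ (S₀ : SteinStructure X₀) (α₀ : MForm (𝓡 3) bX₀.carrier ℝ 1),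
          ob₀.IsGirouxForm (boundaryPlaneField S₀.J bX₀) α₀ ∧
          ∀ (y : bX₀.carrier) (a : ↥(coresComplement h))
            (u : Fin 3 → EuclideanSpace ℝ (Fin 3)) (v : Fin 3 → EuclideanSpace ℝ (Fin 4)),
            bX₀.incl y = D₀.jA a →
            (∀ j, mfderiv (𝓡 3) (𝓡∂ 4) bX₀.incl y (u j) =
              mfderiv (𝓡∂ 4) (𝓡∂ 4) D₀.jA a (v j)) →
            IsPosBdryFrame h a v →
            0 < wedge₁₂ (α₀ y) (mextDeriv α₀ y) (u 0) (u 1) (u 2) := by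
  classical
  -- every point of the base lies in the cores-complement of an empty family
  have hmem : ∀ a : Base g, a ∈ coresComplement h := fun a =>
    (mem_coresComplement h).2 fun i => isEmptyElim i
  let D : MultiAttachmentData h (𝓡∂ 4) (Base g) :=
    { disjoint := fun i => isEmptyElim i
      jA := Subtype.val
      jB := fun i => isEmptyElim i
      hjA := Manifold.IsSmoothEmbedding.of_opens _
      hjAo := (coresComplement h).isOpenEmbedding'.isOpen_range
      hjB := fun i => isEmptyElim i
      cover := by
        refine eq_univ_of_forall fun a => Or.inl ?_
        exact ⟨⟨a, hmem a⟩, rfl⟩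
      glue := fun i => isEmptyElim i
      disjointB := fun i => isEmptyElim i }
  have hK : IsKasOpenBookOf g h D (bBase g).incl (boundaryOpenBook g) := by
    constructor
    · -- (K1) the binding is the image of `{w = 0} ∩ ∂ Base g`
      intro y
      rw [mem_binding_boundaryOpenBook_iff]
      constructor
      · intro hw
        exact ⟨⟨(bBase g).incl y, hmem _⟩, rfl, hw⟩
      · rintro ⟨a, ha, hw⟩
        have : (bBase g).incl y = (a : Base g) := ha
        rw [this]
        exact hw
    · -- (K2) off the binding the fibration is the page angle `w / ‖w‖`
      intro y a hya hw
      have hya' : (bBase g).incl y = (a : Base g) := hya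
      have hw' : w g ((bBase g).incl y).1 ≠ 0 := by rw [hya']; exact hw
      have hproj := proj_boundaryOpenBook g y hw'
      rw [hya'] at hproj
      show toC (((boundaryOpenBook g).proj y : Metric.sphere (0 : EuclideanSpace ℝ (Fin 2)) 1) :
          EuclideanSpace ℝ (Fin 2)) = _
      rw [hproj, toC_smul, toC_vec2, Complex.ofReal_inv]
      exact (div_eq_inv_mul _ _).symm
  exact ⟨Base g, inferInstance, inferInstance, inferInstance, inferInstance, inferInstance, D,
    bBase g, boundaryOpenBook g, hK,
    palf_stein_supportedByBoundaryOpenBook_handleFree g h D (bBase g) (boundaryOpenBook g) hK⟩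

/-! ### The induction over the Lefschetz handles -/

/-- **`palf_stein_supportedByBoundaryOpenBook` follows from its one-handle step** (the
induction of Akbulut–Ozbagci 2001, proof of Thm. 5 / Baykur 2006, p. 14 / Etnyre 2006, proof of
Thm. 5.6, made formal).  Hypothesis `Hstep` (the printed inductive step, displayed inline): for
every positive allowable family `h` of 2-handle attaching maps on `Base g` (attaching circles in
pages, non-zero shadows, page twisting `-1`) which has a MODEL — a compact multi-attachment
`(X₀, D₀)`, a boundary datum `bX₀`, a Kas open book `ob₀`, a Stein structure `S₀` and a Giroux
form `α₀` of `ob₀` for its complex tangencies, positive on the positive boundary frames — and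
every further attaching map `h'` whose range misses the ranges of the `h i`, with attaching
circle in a page, non-zero shadow and page twisting `-1`, the extended family `consFamily h' h`
(`none ↦ h'`, `some i ↦ h i`; `HandleAttachingMapsAssoc.lean`) has a model.  Conclusion: the
named fact.  Proof: induction on the number of handles — the empty family has the model `Base g`
(`exists_palfModel_of_isEmpty`, i.e. `palf_stein_supportedByBoundaryOpenBook_handleFree`); a
family on a non-empty index type `ι ∋ i₀` is the re-indexing along
`Equiv.optionSubtypeNe i₀ : Option {i // i ≠ i₀} ≃ ι` of `consFamily (h i₀) (h|_{i ≠ i₀})`, whose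
model comes from `Hstep` and the induction hypothesis and is transported back by
`exists_palfModel_congr`, `exists_palfModel_of_comp_equiv`; finally a model of `h` gives the
conclusion for every multi-attachment of `h` (`palf_conclusion_of_model`).  (From a model of `h`
the prover of `Hstep` also has the conclusion for EVERY multi-attachment of `h`, by the same
`palf_conclusion_of_model`.) [cite: AkbulutOzbagci2001, Thm. 5] [cite: Baykur2006, p. 14]
[cite: Etnyre2006, Thms. 5.4–5.6] -/
theorem palf_stein_supportedByBoundaryOpenBook_of_consStep
    (Hstep : ∀ (g : ℕ) (ι : Type) [Finite ι] (h : ι → HandleAttachingMap 3 2 (Base g))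
        (h' : HandleAttachingMap 3 2 (Base g)),
      (∀ i, Disjoint (range h'.toFun) (range (h i).toFun)) →
      (∃ c : ℂ, ‖c‖ = 1 ∧ ∀ θ, h'.attachingCircle θ ∈ page g c) →
      shadow g h'.attachingCircle h'.continuous_attachingCircle ≠ 0 →
      pageTwisting g h'.attachingCircle h'.attachingFraming = -1 →
      (∀ i, ∃ c : ℂ, ‖c‖ = 1 ∧ ∀ θ, (h i).attachingCircle θ ∈ page g c) →
      (∀ i, shadow g (h i).attachingCircle (h i).continuous_attachingCircle ≠ 0) →
      (∀ i, pageTwisting g (h i).attachingCircle (h i).attachingFraming = -1) →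
      (∃ (X₀ : Type) (_ : TopologicalSpace X₀) (_ : T2Space X₀)
        (_ : ChartedSpace (EuclideanHalfSpace 4) X₀) (_ : IsManifold (𝓡∂ 4) ∞ X₀)
        (_ : CompactSpace X₀) (D₀ : MultiAttachmentData h (𝓡∂ 4) X₀)
        (bX₀ : BoundaryData (𝓡∂ 4) X₀ (𝓡 3)) (ob₀ : OpenBook bX₀.carrier),
        IsKasOpenBookOf g h D₀ bX₀.incl ob₀ ∧
        ∃ (S₀ : SteinStructure X₀) (α₀ : MForm (𝓡 3) bX₀.carrier ℝ 1),
          ob₀.IsGirouxForm (boundaryPlaneField S₀.J bX₀) α₀ ∧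
          ∀ (y : bX₀.carrier) (a : ↥(coresComplement h))
            (u : Fin 3 → EuclideanSpace ℝ (Fin 3)) (v : Fin 3 → EuclideanSpace ℝ (Fin 4)),
            bX₀.incl y = D₀.jA a →
            (∀ j, mfderiv (𝓡 3) (𝓡∂ 4) bX₀.incl y (u j) =
              mfderiv (𝓡∂ 4) (𝓡∂ 4) D₀.jA a (v j)) →
            IsPosBdryFrame h a v →
            0 < wedge₁₂ (α₀ y) (mextDeriv α₀ y) (u 0) (u 1) (u 2)) →
      ∃ (X₁ : Type) (_ : TopologicalSpace X₁) (_ : T2Space X₁)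
        (_ : ChartedSpace (EuclideanHalfSpace 4) X₁) (_ : IsManifold (𝓡∂ 4) ∞ X₁)
        (_ : CompactSpace X₁) (D₁ : MultiAttachmentData (consFamily h' h) (𝓡∂ 4) X₁)
        (bX₁ : BoundaryData (𝓡∂ 4) X₁ (𝓡 3)) (ob₁ : OpenBook bX₁.carrier),
        IsKasOpenBookOf g (consFamily h' h) D₁ bX₁.incl ob₁ ∧
        ∃ (S₁ : SteinStructure X₁) (α₁ : MForm (𝓡 3) bX₁.carrier ℝ 1),
          ob₁.IsGirouxForm (boundaryPlaneField S₁.J bX₁) α₁ ∧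
          ∀ (y : bX₁.carrier) (a : ↥(coresComplement (consFamily h' h)))
            (u : Fin 3 → EuclideanSpace ℝ (Fin 3)) (v : Fin 3 → EuclideanSpace ℝ (Fin 4)),
            bX₁.incl y = D₁.jA a →
            (∀ j, mfderiv (𝓡 3) (𝓡∂ 4) bX₁.incl y (u j) =
              mfderiv (𝓡∂ 4) (𝓡∂ 4) D₁.jA a (v j)) →
            IsPosBdryFrame (consFamily h' h) a v →
            0 < wedge₁₂ (α₁ y) (mextDeriv α₁ y) (u 0) (u 1) (u 2)) :
    palf_stein_supportedByBoundaryOpenBook := by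
  -- every positive allowable pairwise-disjoint family has a model, by induction on the number
  -- of handles
  have key : ∀ (n : ℕ) (g : ℕ) (ι : Type) [Finite ι], Nat.card ι = n →
      ∀ (h : ι → HandleAttachingMap 3 2 (Base g)),
      (Pairwise fun i j => Disjoint (range (h i).toFun) (range (h j).toFun)) →
      (∀ i, ∃ c : ℂ, ‖c‖ = 1 ∧ ∀ θ, (h i).attachingCircle θ ∈ page g c) →
      (∀ i, shadow g (h i).attachingCircle (h i).continuous_attachingCircle ≠ 0) →
      (∀ i, pageTwisting g (h i).attachingCircle (h i).attachingFraming = -1) →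
      ∃ (X₀ : Type) (_ : TopologicalSpace X₀) (_ : T2Space X₀)
        (_ : ChartedSpace (EuclideanHalfSpace 4) X₀) (_ : IsManifold (𝓡∂ 4) ∞ X₀)
        (_ : CompactSpace X₀) (D₀ : MultiAttachmentData h (𝓡∂ 4) X₀)
        (bX₀ : BoundaryData (𝓡∂ 4) X₀ (𝓡 3)) (ob₀ : OpenBook bX₀.carrier),
        IsKasOpenBookOf g h D₀ bX₀.incl ob₀ ∧
        ∃ (S₀ : SteinStructure X₀) (α₀ : MForm (𝓡 3) bX₀.carrier ℝ 1),
          ob₀.IsGirouxForm (boundaryPlaneField S₀.J bX₀) α₀ ∧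
          ∀ (y : bX₀.carrier) (a : ↥(coresComplement h))
            (u : Fin 3 → EuclideanSpace ℝ (Fin 3)) (v : Fin 3 → EuclideanSpace ℝ (Fin 4)),
            bX₀.incl y = D₀.jA a →
            (∀ j, mfderiv (𝓡 3) (𝓡∂ 4) bX₀.incl y (u j) =
              mfderiv (𝓡∂ 4) (𝓡∂ 4) D₀.jA a (v j)) →
            IsPosBdryFrame h a v →
            0 < wedge₁₂ (α₀ y) (mextDeriv α₀ y) (u 0) (u 1) (u 2) := by
    intro n
    refine Nat.strong_induction_on n ?_
    intro n IH g ι _ hn h hdisj hpage hsh htw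
    rcases isEmpty_or_nonempty ι with hι | ⟨⟨i₀⟩⟩
    · exact exists_palfModel_of_isEmpty g h
    · classical
      -- the sub-family missing `i₀`, on `ι' = {i // i ≠ i₀}`, has a model by induction
      have hlt : Nat.card {i : ι // i ≠ i₀} < n := by
        rw [← hn]
        exact Finite.card_subtype_lt (p := fun i : ι => i ≠ i₀) (x := i₀) (not_not.mpr rfl)
      have Hsub := IH _ hlt g {i : ι // i ≠ i₀} rfl (fun j => h j.1)
        (fun j j' hne => hdisj fun e => hne (Subtype.ext e))
        (fun j => hpage j.1) (fun j => hsh j.1) (fun j => htw j.1)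
      -- one more handle, along `h i₀`
      have Hcons := Hstep g {i : ι // i ≠ i₀} (fun j => h j.1) (h i₀)
        (fun j => hdisj (Ne.symm j.2)) (hpage i₀) (hsh i₀) (htw i₀)
        (fun j => hpage j.1) (fun j => hsh j.1) (fun j => htw j.1) Hsub
      -- `consFamily (h i₀) (h|_{ι'})` is `h` re-indexed along `Option ι' ≃ ι`
      have hfam : consFamily (h i₀) (fun j : {i : ι // i ≠ i₀} => h j.1) =
          h ∘ (Equiv.optionSubtypeNe i₀) := by
        funext o
        cases o <;> rfl
      exact exists_palfModel_of_comp_equiv (Equiv.optionSubtypeNe i₀)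
        (exists_palfModel_congr hfam Hcons)
  -- the fact: transport the model's conclusion to the given multi-attachment
  intro g ι _ X _ _ _ _ _ _ h D bX ob hpage hsh htw hK
  obtain ⟨X₀, _, _, _, _, _, D₀, bX₀, ob₀, hK₀, H₀⟩ :=
    key _ g ι rfl h D.disjoint hpage hsh htw
  exact palf_conclusion_of_model hpage hK₀ hK H₀

end Literature.Geometry.Symplectic

end
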